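import Summits.ABC.StewartYu.GenThreeFrameSpecTwo
import Literature.NumberTheory.DiophantineGeometry.MultiplicativeGroupApproximationProofs
import HarnessLib

/-!
# Cell abc-stewartyu, Gen-3 frame at `p = 2` (crux `Y07Two`, stmt-ABC-19659): the BASE RANKS `n = 0, 1`
# of the per-rank dichotomy, and the engine text from the frame at ranks `≥ 2`

`Summits/ABC/StewartYu/GenThreeBaseTwo.lean` — cell `abc-stewartyu` (HOME `run/shared/lean/pub/abc-stewartyu/`),
route `PadicPrimesKummerThird`, seat p3 (g5), F-two LEAD of the crux `Y07Two`.  Theorems only.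

Matveev's induction (`GenThreeInductionTwo.core_of_dichotomy`) needs the dichotomy `DichotomyTwo C n` at
EVERY rank.  Rank `0` is vacuous (`b ≠ 0` is impossible on `Fin 0`).  Rank `1` is ONE `2`-adic logarithm
and needs no auxiliary construction: for `θ ≡ 1 (mod 8)` and `m ≠ 0` the `2`-adic logarithm is an isometry
on the principal units, so

  `ord₂(θᵐ − 1) = ord₂(θ − 1) + ord₂(m)`  (`padicValRat_zpow_sub_one_eq`, via
  `PadicExp.norm_exp_mul_plog_sub_one` in `ℚ₂`: `‖exp(m·log θ) − 1‖ = ‖m‖·‖1 − θ‖`),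

and `ord₂(θ − 1)·log 2 ≤ h(θ − 1) ≤ h(θ) + log 2`, `ord₂(m)·log 2 ≤ log|m|` give
`ord₂(θᵐ − 1) ≤ (A + W + log 2)/log 2 ≤ 4·A·(W + log 2Amax)` — `dichotomyTwo_one` for `4 ≤ C 1`.
Consequently the analytic frame is owed only at ranks `n ≥ 2` (where the `b`-eliminated directions
exist): `engineTwo_of_frame_two_le`.

WHAT THIS IS NOT: no analytic content; no crux moves.

References: N. Koblitz, GTM 58, Ch. IV §1–2 (the `2`-adic `exp`/`log` isometry); K. Yu, Compositio Math. 74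
(1990), §1.1 (`p = 2`); Yu. V. Nesterenko, LNM 1819 (2003), Thm 2.1 (the case `n = 1`).
-/

noncomputable section

open Finset
open Literature.NumberTheory.Transcendental

namespace Summit.ABC.StewartYu.GenThreeBaseTwo

open Summit.ABC.StewartYu.GenThreeInductionTwo
open Summit.ABC.StewartYu.GenThreeFrameSpecTwo

/-! ### `ord₂(θᵐ − 1) = ord₂(θ − 1) + ord₂(m)` for `θ ≡ 1 (mod 8)` -/

/-- **The `2`-adic logarithm is an isometry on the principal units `≡ 1 (mod 8)`**: for a rational
`θ` with `3 ≤ ord₂(θ − 1)` and an integer `m ≠ 0`, `ord₂(θᵐ − 1) = ord₂(θ − 1) + ord₂(m)`.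
(In `ℚ₂`: `θᵐ = exp(m·plog θ)` and `‖exp(m·plog θ) − 1‖ = ‖m‖·‖1 − θ‖`.)
[cite: Koblitz1984, Ch. IV §2] -/
theorem padicValRat_zpow_sub_one_eq {θ : ℚ} (hθ : 3 ≤ padicValRat 2 (θ - 1)) {m : ℤ} (hm : m ≠ 0) :
    padicValRat 2 (θ ^ m - 1) = padicValRat 2 (θ - 1) + padicValInt 2 m := by
  haveI : Fact (Nat.Prime 2) := ⟨Nat.prime_two⟩
  set y : ℚ_[2] := (θ : ℚ_[2]) with hy
  have hy1 : ‖1 - y‖ < ((2 : ℕ) : ℝ)⁻¹ := TwoAdic.norm_one_sub_lt_half_of_three_le hθ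
  have hmc : ‖(m : ℚ_[2])‖ ≤ 1 := by
    have h := Padic.norm_int_le_one (p := 2) m
    simpa using h
  -- `‖y^m - 1‖ = ‖m‖ · ‖1 - y‖`
  have hkey : ‖y ^ m - 1‖ = ‖(m : ℚ_[2])‖ * ‖1 - y‖ := by
    rw [← PadicExp.exp_intCast_mul_plog_of_norm_lt (ℓ := 2) hy1 m]
    exact PadicExp.norm_exp_mul_plog_sub_one (ℓ := 2) hy1 hmc
  -- the three quantities are nonzero rationals; read the norms as powers of `2`
  have hθ1 : θ ≠ 1 := TwoSetup.ne_one_of_three_le hθ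
  have hθ0 : θ ≠ 0 := TwoSetup.ne_zero_of_three_le hθ
  have hsub : θ - 1 ≠ 0 := sub_ne_zero.mpr hθ1
  have hθv : padicValRat 2 θ = 0 := padicValRat_eq_zero_of_three_le hθ
  have hpow1 : θ ^ m ≠ 1 := by
    intro h1
    -- `θ^m = 1`, `m ≠ 0` ⇒ `θ = ±1`; `θ = -1` contradicts `θ ≡ 1 (mod 8)`
    have h2 : ‖(m : ℚ_[2])‖ * ‖1 - y‖ = 0 := by
      rw [← hkey, hy]
      have e : (θ : ℚ_[2]) ^ m - 1 = ((θ ^ m - 1 : ℚ) : ℚ_[2]) := by push_cast; ring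
      rw [e, h1, sub_self, Rat.cast_zero, norm_zero]
    rcases mul_eq_zero.mp h2 with h3 | h3
    · exact hm (by exact_mod_cast (norm_eq_zero.mp h3))
    · apply hθ1
      have : (1 : ℚ_[2]) - y = 0 := norm_eq_zero.mp h3
      have h4 : (θ : ℚ_[2]) = ((1 : ℚ) : ℚ_[2]) := by rw [Rat.cast_one]; exact (sub_eq_zero.mp this).symm
      exact_mod_cast h4
  have hsubm : θ ^ m - 1 ≠ 0 := sub_ne_zero.mpr hpow1
  have e1 : ‖y ^ m - 1‖ = ((2 : ℕ) : ℝ) ^ (-padicValRat 2 (θ ^ m - 1)) := by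
    have : y ^ m - 1 = ((θ ^ m - 1 : ℚ) : ℚ_[2]) := by rw [hy]; push_cast; ring
    rw [this, Padic.norm_eq_zpow_neg_valuation (by exact_mod_cast hsubm), Padic.valuation_ratCast]
  have e2 : ‖1 - y‖ = ((2 : ℕ) : ℝ) ^ (-padicValRat 2 (θ - 1)) := by
    have : 1 - y = -((θ - 1 : ℚ) : ℚ_[2]) := by rw [hy]; push_cast; ring
    rw [this, norm_neg, Padic.norm_eq_zpow_neg_valuation (by exact_mod_cast hsub),
      Padic.valuation_ratCast]
  have e3 : ‖(m : ℚ_[2])‖ = ((2 : ℕ) : ℝ) ^ (-(padicValInt 2 m : ℤ)) := by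
    have : (m : ℚ_[2]) = ((m : ℚ) : ℚ_[2]) := by push_cast; rfl
    rw [this, Padic.norm_eq_zpow_neg_valuation (by exact_mod_cast hm), Padic.valuation_ratCast,
      padicValRat.of_int]
  rw [e1, e2, e3, ← zpow_add₀ (by norm_num : ((2 : ℕ) : ℝ) ≠ 0)] at hkey
  have hinj := zpow_right_injective₀ (a := ((2 : ℕ) : ℝ)) (by norm_num) (by norm_num) hkey
  linarith

/-- `ord₂(m)·log 2 ≤ log |m|` for an integer `m ≠ 0` (`2^{ord₂ m} ∣ m`). [folklore] -/
theorem padicValInt_mul_log_two_le {m : ℤ} (hm : m ≠ 0) :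
    (padicValInt 2 m : ℝ) * Real.log 2 ≤ Real.log (|m| : ℝ) := by
  have hdvd : ((2 : ℕ) : ℤ) ^ padicValInt 2 m ∣ m := padicValInt_dvd m
  have hle : (2 : ℤ) ^ padicValInt 2 m ≤ |m| := by
    have h1 := Int.le_of_dvd (abs_pos.mpr hm) ((dvd_abs _ _).mpr hdvd)
    simpa using h1
  have hle' : (2 : ℝ) ^ padicValInt 2 m ≤ (|m| : ℝ) := by
    have : ((2 : ℤ) ^ padicValInt 2 m : ℝ) ≤ ((|m| : ℤ) : ℝ) := by exact_mod_cast hle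
    simpa [Int.cast_pow, Int.cast_abs] using this
  have hpos : (0 : ℝ) < (2 : ℝ) ^ padicValInt 2 m := by positivity
  calc (padicValInt 2 m : ℝ) * Real.log 2 = Real.log ((2 : ℝ) ^ padicValInt 2 m) := by
        rw [Real.log_pow]
    _ ≤ Real.log (|m| : ℝ) := Real.log_le_log hpos hle'

/-- `ord₂(θ − 1)·log 2 ≤ h(θ) + log 2` for `θ ≠ 1`. [folklore] -/
theorem padicValRat_sub_one_mul_log_two_le {θ : ℚ} (hθ1 : θ ≠ 1) :
    (padicValRat 2 (θ - 1) : ℝ) * Real.log 2 ≤ Height.logHeight₁ θ + Real.log 2 := by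
  have hsub : θ - 1 ≠ 0 := sub_ne_zero.mpr hθ1
  have h1 := Literature.NumberTheory.DiophantineGeometry.Dioph.padicValRat_mul_log_le_logHeight₁ 2
    Nat.prime_two hsub
  have h2 : Height.logHeight₁ (θ - 1) ≤ Real.log 2 + Height.logHeight₁ θ := by
    have h := Literature.NumberTheory.DiophantineGeometry.Dioph.logHeight₁_one_sub_le θ
    rwa [← Height.logHeight₁_neg, neg_sub] at h
  have h3 : ((2 : ℕ) : ℝ) = 2 := by norm_num
  rw [h3] at h1
  linarith

/-! ### The base ranks -/

/-- Rank `0` of the dichotomy is vacuous (`b ≠ 0` is impossible on `Fin 0`). [folklore] -/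
theorem dichotomyTwo_zero (C : ℕ → ℝ) : DichotomyTwo C 0 := by
  intro α b V Vmax W _ _ _ _ _ _ hb _ _
  exact absurd (funext fun j => Fin.elim0 j) hb

/-- **Rank `1` of the dichotomy by the `2`-adic logarithm alone**: for `4 ≤ C 1`,
`ord₂(θᵐ − 1) = ord₂(θ − 1) + ord₂(m) ≤ (h(θ) + log 2 + log|m|)/log 2 ≤ 4·A·(W + log 2Amax)`.
[cite: Yu1990, §1.1 (p = 2); shape only] -/
theorem dichotomyTwo_one {C : ℕ → ℝ} (hC : 4 ≤ C 1) : DichotomyTwo C 1 := by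
  intro α b V Vmax W hα _hind _hK hV hV1 hVmax hb hW hW1
  left
  have hb0 : b 0 ≠ 0 := by
    intro h0; apply hb; funext j
    have : j = 0 := Subsingleton.elim _ _
    rw [this, h0]; rfl
  have hθ := hα 0
  have hθ1 : α 0 ≠ 1 := TwoSetup.ne_one_of_three_le hθ
  -- the product over `Fin 1`
  have hprod : ∏ j : Fin 1, α j ^ b j = α 0 ^ b 0 := by
    rw [Fin.prod_univ_one]
  have hprodV : ∏ j : Fin 1, V j = V 0 := by rw [Fin.prod_univ_one]
  rw [hprod, hprodV, padicValRat_zpow_sub_one_eq hθ hb0]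
  push_cast
  -- the two elementary bounds
  have hlog2 := Real.log_two_gt_d9
  have hlog2' := Real.log_two_lt_d9
  have h1 : (padicValRat 2 (α 0 - 1) : ℝ) * Real.log 2 ≤ V 0 + Real.log 2 :=
    (padicValRat_sub_one_mul_log_two_le hθ1).trans (by linarith [hV 0])
  have h2 : (padicValInt 2 (b 0) : ℝ) * Real.log 2 ≤ W := by
    refine (padicValInt_mul_log_two_le hb0).trans ?_
    have hpos : (0 : ℝ) < |(b 0 : ℝ)| := abs_pos.mpr (by exact_mod_cast hb0)
    have h3 : Real.log (|(b 0 : ℝ)|) ≤ Real.log (max 3 (|(b 0 : ℝ)|)) :=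
      Real.log_le_log hpos (le_max_right _ _)
    exact h3.trans (hW 0)
  have hA1 := hV1 0
  have hAmax : 1 ≤ Vmax := hA1.trans (hVmax 0)
  have hl2V : Real.log 2 ≤ Real.log (2 * Vmax) := Real.log_le_log two_pos (by linarith)
  -- `(v₁ + v₂)·log 2 ≤ V 0 + log 2 + W`, and `V 0 + log 2 + W ≤ 4·log 2·V 0·(W + log 2Vmax)`
  have hsum : ((padicValRat 2 (α 0 - 1) : ℝ) + (padicValInt 2 (b 0) : ℝ)) * Real.log 2 ≤
      V 0 + Real.log 2 + W := by linarith
  have htarget : V 0 + Real.log 2 + W ≤ Real.log 2 * (C 1 * V 0 * (W + Real.log (2 * Vmax))) := by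
    have hVW : V 0 + W ≤ 2 * (V 0 * W) := by nlinarith
    have hC0 : 0 ≤ C 1 - 4 := by linarith
    have hprod0 : 0 ≤ V 0 * (W + Real.log (2 * Vmax)) := by
      have : 0 ≤ W + Real.log (2 * Vmax) := by linarith
      exact mul_nonneg (by linarith) this
    have hsplit : C 1 * V 0 * (W + Real.log (2 * Vmax)) =
        4 * (V 0 * (W + Real.log (2 * Vmax))) + (C 1 - 4) * (V 0 * (W + Real.log (2 * Vmax))) := by
      ring
    rw [hsplit]
    have h4 : 0 ≤ (C 1 - 4) * (V 0 * (W + Real.log (2 * Vmax))) := mul_nonneg hC0 hprod0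
    nlinarith [mul_nonneg (show (0:ℝ) ≤ V 0 by linarith) (show (0:ℝ) ≤ Real.log (2 * Vmax) by linarith)]
  have hfin : ((padicValRat 2 (α 0 - 1) : ℝ) + (padicValInt 2 (b 0) : ℝ)) * Real.log 2 ≤
      (C 1 * V 0 * (W + Real.log (2 * Vmax))) * Real.log 2 := by
    have := hsum.trans htarget; linarith
  exact le_of_mul_le_mul_right hfin (by linarith)

/-! ### The engine text from the frame at ranks `≥ 2` -/

/-- **The frozen `GenThreeEngineTwo` text from the zero estimate, an admissible `C ≤ c₁ⁿ` with
`4 ≤ C 1`, and the analytic frame at every rank `n ≥ 2`.**  (Ranks `0, 1` are `dichotomyTwo_zero`,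
`dichotomyTwo_one`.) [cite: Yu2007, Main Thm (K = ℚ, ℘ = 2); shape only] -/
theorem engineTwo_of_frame_two_le {C : ℕ → ℝ} {c₁ : ℝ} (hc₁ : 1 ≤ c₁)
    (hC : ∀ m, 0 ≤ C m ∧ C m ≤ c₁ ^ m) (hC1 : 4 ≤ C 1)
    (hF : Nesterenko2003_prop51 → ∀ n, 2 ≤ n → FrameTwo C n) (hZ : Nesterenko2003_prop51) :
    ∃ (C : ℕ → ℝ) (c₁ : ℝ), 1 ≤ c₁ ∧ (∀ m, 0 ≤ C m ∧ C m ≤ c₁ ^ m) ∧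
      ∀ (m : ℕ) (α : Fin m → ℚ) (b : Fin m → ℤ) (V : Fin m → ℝ) (Vmax W : ℝ),
        (∀ j, ∃ a : ℤ, α j = a) →
        (∀ j, 3 ≤ padicValRat 2 (α j - 1)) →
        (∀ μ : Fin m → ℤ, ∏ j, α j ^ μ j = 1 → μ = 0) →
        (∀ κ : Fin m → ℕ, (∃ j, ¬ 3 ∣ κ j) → ∀ γ : ℚ, ∏ j, α j ^ κ j ≠ γ ^ 3) →
        (∀ j, Height.logHeight₁ (α j) ≤ V j) → (∀ j, 1 ≤ V j) → (∀ j, V j ≤ Vmax) →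
        b ≠ 0 → (∀ j, Real.log (max 3 (|b j| : ℝ)) ≤ W) → 1 ≤ W →
        (padicValRat 2 (∏ j, α j ^ b j - 1) : ℝ) ≤ C m * (∏ j, V j) * (W + Real.log (2 * Vmax)) := by
  refine engineTwo_of_dichotomy hc₁ hC (fun hZ' n => ?_) hZ
  rcases Nat.lt_or_ge n 2 with hn | hn
  · interval_cases n
    · exact dichotomyTwo_zero C
    · exact dichotomyTwo_one hC1
  · exact dichotomyTwo_of_frame hZ' (fun r => (hC r).1) (hF hZ' n hn)

end Summit.ABC.StewartYu.GenThreeBaseTwo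

end
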